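import Literature.MathematicalPhysics.QuantumFieldTheory.Balaban1985CMP102.Setting
import Literature.MathematicalPhysics.QuantumFieldTheory.Balaban1983to89.B10Eq11Trace

/-!
# `Summit.QuantumFields.Balaban3D.Proofs.GroupModelEq11` — [Balaban1985UV3] **(11)** p. 258 (the small factor of a large-field
# plaquette, «smaller than any positive power of ε») for the lane's gauge group AS TYPED (`Balaban1985CMP102.Setting.GroupModel`:
# `|·−1|` = operator norm, `Re tr` = normalized trace of a faithful unitary realisation in `U(N)`) — lane `pub-balaban3d`, seat p4
# (PLAN.md §3.1 l.138 «(11) small factor», §3.4 «p4 ← (7)–(22)», §0.5 E2)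

HONEST FRAMING (lane PLAN.md §0, binding): see `…Proofs.SectAFirstStep`.  Nothing of [Balaban1985UV3] beyond display (11) is
touched; (11) is elementary and is PROVED here for the spine's group model, with the dimension-dependent constant that the
operator-norm reading forces made explicit (cell pub-balaban DIVERGENCE D-b10.1).

WHAT IS PRINTED.  p. 258 = PDF 4 L17–22 (render `…/1985-cmp102-uv-stability-3d/…-p004-x2.png`), verbatim: «For each plaquette
p ∈ P, where P is one of the sets occurring in the definition of ζ_{Ω₁ᶜ}, we have
exp[−(1/g₀²)[1 − Re tr U(∂p)]] = exp[−(1/2g₀²)|U(∂p) − 1|²] ≤ exp(−½p²(g₀)), (11) and by the definition of g₀ = gε^{1/2} the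
number on the right-hand side is smaller than any positive power of ε. These are small factors assigned to plaquettes in
P, and they produce convergence factors needed for a convergent expansion.»  Context: (7) p. 257 L31–35 «we take ε₁ = g₀p(g₀),
where p(g) = b₀(1 + log g^{−1})^{p₀}, p₀ > 2 and b₀ is a sufficiently large absolute constant»; a plaquette of P violates the
small-field condition (4) p. 256 L26 «|U(∂p) − 1| < ε₁», i.e. has |U(∂p) − 1| ≥ g₀p(g₀).

WHAT LQB ALREADY HAS (RE-USED BY NAME): `B10Eq11Trace.eq11_opNorm` — for `U ∈ U(N)`, `‖U − 1‖²_op ≤ 2N(1 − Re Tr U/N)` (the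
middle member of (11) in the operator-norm reading of [4] (19); the printed EQUALITY `1 − Re tr U = ½|U − 1|²` holds for the
normalized Hilbert–Schmidt norm, `B10Eq11Trace.eq11_normalized`); `B10.pFun` = p(g) and `B10.smallFactor_le_pow` — for
`0 < g ≤ 1`, `p₀ ≥ 1`, `b₀² ≥ K`: `exp(−½p(g)²) ≤ g^K` (the clause «smaller than any positive power of ε», quantitatively).

WHAT THIS FILE PROVES (no `sorry`, axioms standard), for `M : Setting.GroupModel G` and a group element `w` (= a plaquette
variable `U(∂p)`):
* §1 `sq_dist1_le` — `|w − 1|² ≤ 2N·(1 − Re tr w)` in the spine's interface functions (`dist1`, `reTr` pinned to the model by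
  `M.dist1_eq`, `M.reTr_eq`): (11)'s middle member for the lane's G, with the honest factor `2N` in place of the printed `2`;
* §2 `eq11_smallFactor` — **(11)**: if `|w − 1| ≥ ε₁ ≥ 0` then `exp[−(1/g₀²)(1 − Re tr w)] ≤ exp[−ε₁²/(2N g₀²)]`; with ε₁ = g₀p(g₀),
  `eq11_smallFactor_pFun`: `≤ exp[−p(g₀)²/(2N)]`;
* §3 `eq11_le_pow` — «smaller than any positive power»: for `0 < g₀ ≤ 1`, `p₀ ≥ 1` and `b₀² ≥ K·N` (the printed «b₀ is a
  sufficiently large absolute constant», the largeness now carrying the dimension N of the realisation),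
  `exp[−(1/g₀²)(1 − Re tr w)] ≤ g₀^K` whenever `|w − 1| ≥ g₀p(g₀)` (and `g₀^K = g^K ε^{K/2}` by (1)).
-/

namespace Summit.QuantumFields.Balaban3D.Proofs.GroupModelEq11

open Literature.MathematicalPhysics.QuantumFieldTheory.Balaban1983to89
open Literature.MathematicalPhysics.QuantumFieldTheory.Balaban1985CMP102.Setting (GroupModel)
open scoped Matrix.Norms.L2Operator

variable {G : Type} [GaugeGroup G] [MeasurableSpace G] (M : GroupModel G)

/-! ## §1 The middle member of (11) for the group model -/

/-- **(11)** p. 258, middle member, for the lane's group AS TYPED: `|w − 1|² ≤ 2N(1 − Re tr w)` for every `w ∈ G`, where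
`|·−1| = dist1` is the operator-norm distance and `Re tr = reTr` the normalized real trace of the faithful unitary realisation
`M.ρ : G → U(N)` (`GroupModel.dist1_eq`, `GroupModel.reTr_eq`).  The printed `½|U(∂p) − 1|²` presupposes the normalized
Hilbert–Schmidt norm (cell DIVERGENCE D-b10.1); in the operator norm the constant is `(2N)⁻¹`.  LQB's `B10Eq11Trace.eq11_opNorm`
transported along the spine's interface. [cite: Balaban1985UV3, (11) p.258] -/
theorem sq_dist1_le (w : G) : dist1 w ^ 2 ≤ 2 * (M.N : ℝ) * (1 - reTr w) := by
  haveI : Nonempty (Fin M.N) := ⟨⟨0, M.N_pos⟩⟩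
  have h := B10Eq11Trace.eq11_opNorm (M.ρ w) (M.mem_unitary w)
  rw [Fintype.card_fin] at h
  rw [M.dist1_eq, M.reTr_eq]
  unfold UnitaryModel.opDist1 UnitaryModel.nReTr
  rw [Fintype.card_fin, div_eq_inv_mul]
  exact h

/-- Consequently `(1 − Re tr w) ≥ |w − 1|²/(2N)`. [cite: Balaban1985UV3, (11) p.258] -/
theorem sq_dist1_div_le (w : G) : dist1 w ^ 2 / (2 * M.N) ≤ 1 - reTr w := by
  have hN : (0 : ℝ) < M.N := Nat.cast_pos.mpr M.N_pos
  rw [div_le_iff₀ (by positivity)]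
  have := sq_dist1_le M w
  linarith

/-! ## §2 (11): the small factor of a large-field plaquette -/

/-- **(11)** p. 258 = PDF 4 L17–20 for the lane's group AS TYPED: for a plaquette variable `w = U(∂p)` violating the small-field
condition with threshold `ε₁ ≥ 0`, i.e. `|w − 1| ≥ ε₁`, and `g₀² > 0`,
`exp[−(1/g₀²)[1 − Re tr w]] ≤ exp[−ε₁²/(2N·g₀²)]` (printed with `2` for `2N`, normalized Hilbert–Schmidt reading).
Kernel-checked from §1 and monotonicity of `exp`. [cite: Balaban1985UV3, (11) p.258] -/
theorem eq11_smallFactor (w : G) {g0sq ε₁ : ℝ} (hg : 0 < g0sq) (hε : 0 ≤ ε₁) (hlarge : ε₁ ≤ dist1 w) :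
    Real.exp (-(1 / g0sq) * (1 - reTr w)) ≤ Real.exp (-(ε₁ ^ 2 / (2 * M.N * g0sq))) := by
  apply Real.exp_le_exp.mpr
  have hN : (0 : ℝ) < M.N := Nat.cast_pos.mpr M.N_pos
  have h1 : ε₁ ^ 2 ≤ dist1 w ^ 2 := pow_le_pow_left₀ hε hlarge 2
  have h2 : dist1 w ^ 2 / (2 * M.N) ≤ 1 - reTr w := sq_dist1_div_le M w
  have h3 : ε₁ ^ 2 / (2 * M.N) ≤ 1 - reTr w :=
    (div_le_div_of_nonneg_right h1 (by positivity)).trans h2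
  have h4 : ε₁ ^ 2 / (2 * M.N * g0sq) = (1 / g0sq) * (ε₁ ^ 2 / (2 * M.N)) := by
    field_simp
  rw [h4, neg_mul]
  exact neg_le_neg (mul_le_mul_of_nonneg_left h3 (by positivity))

/-- **(11)** with the printed threshold (7) p. 257 «ε₁ = g₀p(g₀), where p(g) = b₀(1 + log g^{−1})^{p₀}» (`B10.pFun`), `g₀ > 0`,
`b₀ ≥ 0`, `g₀ ≤ 1`: `exp[−(1/g₀²)[1 − Re tr w]] ≤ exp[−p(g₀)²/(2N)]` for `|w − 1| ≥ g₀p(g₀)` (printed: `≤ exp(−½p²(g₀))`).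
[cite: Balaban1985UV3, (11) p.258] -/
theorem eq11_smallFactor_pFun (w : G) {g₀ b₀ p₀ : ℝ} (hg₀ : 0 < g₀) (hg₁ : g₀ ≤ 1) (hb : 0 ≤ b₀)
    (hlarge : g₀ * B10.pFun b₀ p₀ g₀ ≤ dist1 w) :
    Real.exp (-(1 / g₀ ^ 2) * (1 - reTr w)) ≤ Real.exp (-(B10.pFun b₀ p₀ g₀ ^ 2 / (2 * M.N))) := by
  have hp : 0 ≤ B10.pFun b₀ p₀ g₀ := B10.pFun_nonneg b₀ p₀ g₀ hb hg₀ hg₁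
  have h := eq11_smallFactor M w (pow_pos hg₀ 2) (mul_nonneg hg₀.le hp) hlarge
  have hN : (0 : ℝ) < M.N := Nat.cast_pos.mpr M.N_pos
  have hre : (g₀ * B10.pFun b₀ p₀ g₀) ^ 2 / (2 * M.N * g₀ ^ 2) = B10.pFun b₀ p₀ g₀ ^ 2 / (2 * M.N) := by
    field_simp
  rwa [hre] at h

/-! ## §3 «smaller than any positive power of ε» -/

/-- `p(g)/√N` is `p` with `b₀/√N`: `pFun b₀ p₀ g ^ 2 / N = pFun (b₀/√N) p₀ g ^ 2`. [folklore] -/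
theorem pFun_sq_div (b₀ p₀ g : ℝ) {Nr : ℝ} (hN : 0 < Nr) :
    B10.pFun b₀ p₀ g ^ 2 / Nr = B10.pFun (b₀ / Real.sqrt Nr) p₀ g ^ 2 := by
  unfold B10.pFun
  have hs : Real.sqrt Nr ^ 2 = Nr := Real.sq_sqrt hN.le
  have hs0 : Real.sqrt Nr ≠ 0 := (Real.sqrt_pos.mpr hN).ne'
  rw [mul_pow, mul_pow, div_pow, hs]
  field_simp

/-- **(11) + «the number on the right-hand side is smaller than any positive power of ε»** (p. 258 L20–21) for the lane's
group AS TYPED, quantitatively: for `0 < g₀ ≤ 1`, `p₀ ≥ 1`, `b₀ ≥ 0` with `b₀² ≥ K·N` («b₀ is a sufficiently large absolute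
constant», (7) p. 257 — the largeness absorbing the dimension N of the unitary realisation) and a plaquette variable with
`|w − 1| ≥ g₀p(g₀)`: `exp[−(1/g₀²)[1 − Re tr w]] ≤ g₀^K` (`g₀^K = g^K ε^{K/2}` by (1) p. 256 «g₀² = g²ε»).  Kernel-checked:
§2 + LQB's `B10.smallFactor_le_pow` at `b₀/√N`. [cite: Balaban1985UV3, (11) p.258] -/
theorem eq11_le_pow (w : G) {g₀ b₀ p₀ : ℝ} (K : ℕ) (hg₀ : 0 < g₀) (hg₁ : g₀ ≤ 1) (hb : 0 ≤ b₀) (hp : 1 ≤ p₀)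
    (hK : (K : ℝ) * M.N ≤ b₀ ^ 2) (hlarge : g₀ * B10.pFun b₀ p₀ g₀ ≤ dist1 w) :
    Real.exp (-(1 / g₀ ^ 2) * (1 - reTr w)) ≤ g₀ ^ K := by
  have hN : (0 : ℝ) < M.N := Nat.cast_pos.mpr M.N_pos
  refine (eq11_smallFactor_pFun M w hg₀ hg₁ hb hlarge).trans ?_
  have hsplit : B10.pFun b₀ p₀ g₀ ^ 2 / (2 * M.N) = (1 / 2) * (B10.pFun b₀ p₀ g₀ ^ 2 / M.N) := by
    field_simp
  rw [hsplit, pFun_sq_div b₀ p₀ g₀ hN, ← neg_mul]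
  refine B10.smallFactor_le_pow (b₀ / Real.sqrt M.N) p₀ g₀ K (div_nonneg hb (Real.sqrt_nonneg _)) ?_ hp hg₀ hg₁
  rw [div_pow, Real.sq_sqrt hN.le, le_div_iff₀ hN]
  exact hK

end Summit.QuantumFields.Balaban3D.Proofs.GroupModelEq11
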